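import Literature.NumberTheory.EllipticCurves.EisensteinSeriesNebentypusNormalised
import Literature.NumberTheory.EllipticCurves.EisensteinSeriesNebentypusCusps
import Literature.NumberTheory.EllipticCurves.NewformsMainLemmaProofs
import HarnessLib

/-!
# The level-raised Eisenstein series `F₂ = E_k^{𝟙,χ} - E_k^{𝟙,χ}(M·)` of Billerey–Menares

Topic `Literature/NumberTheory/EllipticCurves`; namespace
`Literature.NumberTheory.EllipticCurves.ModularForms`.

For a primitive Dirichlet character `χ` modulo `N` with `χ(-1) = (-1)^k`, `k ≥ 3`, and an integer
`M ≥ 1`, the modular form of Billerey–Menares, §3.2 (proof of Thm. 2, "⟸"), with `χ₁ = 𝟙`,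
`χ₂ = χ`:

  `F₂ = E_k^{𝟙,χ} - α_M E_k^{𝟙,χ}`,  `α_M f (z) = f(Mz)`,  `E_k^{𝟙,χ} = -B_{k,χ}/2k + ∑ σ_{k-1}^χ(n) qⁿ`

as a modular form of weight `k` on `Γ₁(NM)` (`eisensteinLevelRaised`; here
`E_k^{𝟙,χ} = -(B_{k,χ}/4k) • E_k^χ` is `eisensteinE`, `EisensteinSeriesNebentypusNormalised`, and
`α_M` is `M^{1-k}` times the tree's degeneracy slash `[diag(M,1)]_k`, realised on modular forms by
`heckeCorrespondence (Γ₁(N)) (Γ₁(NM)) k diag(M,1)`):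

* `coe_eisensteinLevelRaised`, `eisensteinLevelRaised_apply` — `F₂(τ) = E(τ) - E(Mτ)`;
* `eisensteinLevelRaised_slash_of_mem_gamma0` — nebentypus `χ` on `Γ₀(NM)`;
* `qExpansion_coeff_eisensteinLevelRaised` — `a_0(F₂) = 0`,
  `a_n(F₂) = σ_{k-1}^χ(n) - [M ∣ n] σ_{k-1}^χ(n/M)`; `p`-integrality
  (`valuation_qExpansion_coeff_eisensteinLevelRaised_le_one`, `p ∤ N`, `k < p - 1`);
* `tendsto_eisensteinLevelRaised_slash_atImInfty_of_dvd/_of_isCoprime` — the constant terms of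
  `F₂ ∣_k γ` at `i∞` for all `γ = (a b; c d) ∈ SL₂(ℤ)` (`gcd(M, N) = 1`): `0` if `M ∣ c`, and
  `-(B_{k,χ}/4k) χ(d)(1 + χ(-1)(-1)^k)(1 - χ̄(M)M^{-k}) [N ∣ c]` if `gcd(c, M) = 1`
  (Billerey–Menares Cor. 5 / §3.2: `a_0(F₂ ∣_k γ) = Υ(γ,1)(1 - (r/M)^k (χ₁χ̄₂)(M/r))`);
* `valuation_constTerm_lt_one` — for a prime `M ≠ p` with `χ(M) M^k ≡ 1 (mod 𝔪)` (read in
  `ℚ̄_p` through `ι⁻¹`, `ι : ℚ̄_p ≃ ℂ`), `p ∤ N`, `3 ≤ k < p - 1`, all these constant terms have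
  `‖ι⁻¹(·)‖_p < 1` — the hypothesis "`η(M) M^k = 1`" of B–M Thm. 2 at work.

## References

* N. Billerey, R. Menares, *Strong modularity of reducible Galois representations*, Trans. AMS
  370 (2018), §1.4 (Cor. 5), §3.2 (proof of Thm. 2). [BillereyMenares2018]
* F. Diamond, J. Shurman, *A First Course in Modular Forms*, GTM 228 (2005), §5.6–5.7
  (`[α_d]_k`, `ι_d`). [DiamondShurman2005]
-/

noncomputable section

open Complex UpperHalfPlane Filter Finset ModularForm CongruenceSubgroup Matrix
  Matrix.SpecialLinearGroup
open scoped Real NNReal MatrixGroups Topology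
open Literature.NumberTheory.LFunctions

namespace Literature.NumberTheory.EllipticCurves.ModularForms

/-! ### Definitions -/

section Defs

variable {N : ℕ} [NeZero N] (k : ℕ) (χ : DirichletCharacter ℂ N) (M : ℕ) [NeZero M]

variable (N) in
/-- **`E_k^{𝟙,χ} = -(B_{k,χ}/4k) • E_k^χ`**, the Eisenstein series of weight `k ≥ 3` on `Γ₁(N)` with
nebentypus `χ` and `q`-expansion `-B_{k,χ}/2k + ∑ σ_{k-1}^χ(n) qⁿ` (for `χ` primitive,
`χ(-1) = (-1)^k`; `qExpansion_coeff_bernoulli_smul_eisensteinCharMF`) — the series `E_k^{χ₁,χ₂}` of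
Billerey–Menares §1.3 with `χ₁ = 𝟙`, `χ₂ = χ`. [cite: BillereyMenares2018, §1.3] -/
def eisensteinE (hk : 3 ≤ k) : ModularForm (Gamma1 N) k :=
  (-(generalizedBernoulli k χ) / (4 * k)) • eisensteinCharMF N k χ (by exact_mod_cast hk)

variable (N) in
/-- **The level-raised Eisenstein series `F₂ = E_k^{𝟙,χ} - α_M E_k^{𝟙,χ}` of Billerey–Menares
§3.2** (`χ₁ = 𝟙`), a modular form of weight `k` on `Γ₁(NM)`: `E_k^{𝟙,χ}` viewed at level `NM`
(the Hecke correspondence `[Γ₁(N) 1 Γ₁(NM)]`) minus `M^{1-k} [Γ₁(N) diag(M,1) Γ₁(NM)] E_k^{𝟙,χ}`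
(`= E_k^{𝟙,χ}(M·)`, Diamond–Shurman's `ι_M`). [cite: BillereyMenares2018, §3.2 (proof of Thm. 2)] -/
def eisensteinLevelRaised (hk : 3 ≤ k) : ModularForm (Gamma1 (N * M)) k :=
  heckeCorrespondence (Gamma1 N) (Gamma1 (N * M)) k
      (diagGL ((1 : ℕ) : ℚ) 1 (Nat.cast_pos.mpr Nat.one_pos) one_pos : GL (Fin 2) ℚ)
      (eisensteinE N k χ hk) -
    ((M : ℂ) ^ (1 - (k : ℤ))) •
      heckeCorrespondence (Gamma1 N) (Gamma1 (N * M)) k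
        (diagGL ((M : ℕ) : ℚ) 1 (Nat.cast_pos.mpr (NeZero.pos M)) one_pos : GL (Fin 2) ℚ)
        (eisensteinE N k χ hk)

end Defs

/-! ### `F₂` as a function -/

section Coe

variable {N : ℕ} [NeZero N] (k : ℕ) (χ : DirichletCharacter ℂ N) (M : ℕ) [NeZero M]

/-- `E_k^{𝟙,χ}` as a function: `-(B_{k,χ}/4k) • E_k^χ`. [folklore] -/
theorem coe_eisensteinE (hk : 3 ≤ k) :
    (⇑(eisensteinE N k χ hk) : ℍ → ℂ) =
      (-(generalizedBernoulli k χ) / (4 * k)) • eisensteinChar N k χ := by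
  rw [eisensteinE, IsGLPos.coe_smul, coe_eisensteinCharMF]

/-- `glCast diag(1,1) = 1`. [folklore] -/
theorem glCast_diagGL_one_one :
    glCast ((diagGL ((1 : ℕ) : ℚ) 1 (Nat.cast_pos.mpr Nat.one_pos) one_pos : GL(2, ℚ)⁺) :
      GL (Fin 2) ℚ) = 1 := by
  ext i j
  fin_cases i <;> fin_cases j <;> simp [glCast, diagGL]

/-- The level change `[Γ₁(N) 1 Γ₁(NM)]` is the identity on functions. [cite: DiamondShurman2005, §5.1 (forms of level Γ are forms of every smaller level)] -/
theorem coe_heckeCorrespondence_one (hk : 3 ≤ k) :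
    (⇑(heckeCorrespondence (Gamma1 N) (Gamma1 (N * M)) k
        (diagGL ((1 : ℕ) : ℚ) 1 (Nat.cast_pos.mpr Nat.one_pos) one_pos : GL (Fin 2) ℚ)
        (eisensteinE N k χ hk)) : ℍ → ℂ) = ⇑(eisensteinE N k χ hk) := by
  rw [coe_heckeCorrespondence_eq_sum _ _ k _
    (isDoubleCosetDecomp_diagGL_gamma1 (M := N) (N := N * M) Nat.one_pos (by simp))]
  simp only [univ_unique, sum_singleton, glCast_diagGL_one_one, SlashAction.slash_one]

/-- The degeneracy correspondence `[Γ₁(N) diag(M,1) Γ₁(NM)]` is the single slash `[diag(M,1)]_k`.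
[cite: DiamondShurman2005, §5.6 p. 209] -/
theorem coe_heckeCorrespondence_diagGL (hk : 3 ≤ k) :
    (⇑(heckeCorrespondence (Gamma1 N) (Gamma1 (N * M)) k
        (diagGL ((M : ℕ) : ℚ) 1 (Nat.cast_pos.mpr (NeZero.pos M)) one_pos : GL (Fin 2) ℚ)
        (eisensteinE N k χ hk)) : ℍ → ℂ) =
      ⇑(eisensteinE N k χ hk) ∣[(k : ℤ)] glCast ((diagGL ((M : ℕ) : ℚ) 1
        (Nat.cast_pos.mpr (NeZero.pos M)) one_pos : GL(2, ℚ)⁺) : GL (Fin 2) ℚ) := by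
  rw [coe_heckeCorrespondence_eq_sum _ _ k _
    (isDoubleCosetDecomp_diagGL_gamma1 (M := N) (N := N * M) (NeZero.pos M) dvd_rfl)]
  simp

/-- **`F₂` as a function**: `F₂ = E - M^{1-k} (E ∣_k diag(M,1))`, `E = E_k^{𝟙,χ}`. [cite: BillereyMenares2018, §3.2] -/
theorem coe_eisensteinLevelRaised (hk : 3 ≤ k) :
    (⇑(eisensteinLevelRaised N k χ M hk) : ℍ → ℂ) =
      ⇑(eisensteinE N k χ hk) - ((M : ℂ) ^ (1 - (k : ℤ))) •
        (⇑(eisensteinE N k χ hk) ∣[(k : ℤ)] glCast ((diagGL ((M : ℕ) : ℚ) 1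
          (Nat.cast_pos.mpr (NeZero.pos M)) one_pos : GL(2, ℚ)⁺) : GL (Fin 2) ℚ)) := by
  rw [eisensteinLevelRaised, ModularForm.coe_sub, IsGLPos.coe_smul, coe_heckeCorrespondence_one,
    coe_heckeCorrespondence_diagGL]

/-- **`F₂(τ) = E(τ) - E(Mτ)`**. [cite: BillereyMenares2018, §3.2] -/
theorem eisensteinLevelRaised_apply (hk : 3 ≤ k) (τ : ℍ) :
    eisensteinLevelRaised N k χ M hk τ =
      eisensteinE N k χ hk τ -
        eisensteinE N k χ hk ((⟨(M : ℝ), Nat.cast_pos.mpr (NeZero.pos M)⟩ : {x : ℝ // 0 < x}) • τ) := by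
  have h := congr_fun (coe_eisensteinLevelRaised k χ M hk) τ
  rw [h, Pi.sub_apply, smul_slash_diagGL_apply (k : ℤ) M (NeZero.pos M) _ τ]

/-- `F₂` in terms of `E_k^χ`: `F₂ = -(B_{k,χ}/4k) • (E_k^χ - M^{1-k}(E_k^χ ∣_k diag(M,1)))`. [folklore] -/
theorem coe_eisensteinLevelRaised_eq_smul (hk : 3 ≤ k) :
    (⇑(eisensteinLevelRaised N k χ M hk) : ℍ → ℂ) =
      (-(generalizedBernoulli k χ) / (4 * k)) •
        (eisensteinChar N k χ - ((M : ℂ) ^ (1 - (k : ℤ))) • (eisensteinChar N k χ ∣[(k : ℤ)]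
          glCast ((diagGL ((M : ℕ) : ℚ) 1 (Nat.cast_pos.mpr (NeZero.pos M)) one_pos :
            GL(2, ℚ)⁺) : GL (Fin 2) ℚ))) := by
  rw [coe_eisensteinLevelRaised, coe_eisensteinE, ModularForm.smul_slash, σ_glCast, smul_sub,
    smul_comm]

end Coe

/-! ### Nebentypus -/

section Nebentypus

variable {N : ℕ} [NeZero N] (k : ℕ) (χ : DirichletCharacter ℂ N) (M : ℕ) [NeZero M]

/-- **`F₂` has nebentypus `χ` on `Γ₀(NM)`**: `F₂ ∣_k γ = χ(d) F₂` for `γ = (a b; c d) ∈ Γ₀(NM)`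
(`E ∣_k γ = χ(d) E` on `Γ₀(N) ⊇ Γ₀(NM)`, and `diag(M,1) γ = γ' diag(M,1)` with
`γ' = (a, Mb; c/M, d) ∈ Γ₀(N)`). [cite: BillereyMenares2018, §3.2; DiamondShurman2005, §5.6] -/
theorem eisensteinLevelRaised_slash_of_mem_gamma0 (hk : 3 ≤ k) {γ : SL(2, ℤ)}
    (hγ : γ ∈ Gamma0 (N * M)) :
    (⇑(eisensteinLevelRaised N k χ M hk) : ℍ → ℂ) ∣[(k : ℤ)] γ =
      χ ((γ 1 1 : ℤ) : ZMod N) • (⇑(eisensteinLevelRaised N k χ M hk) : ℍ → ℂ) := by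
  have hNMc : ((N : ℤ) * M) ∣ γ 1 0 := by
    have h := hγ
    rw [Gamma0_mem, ZMod.intCast_zmod_eq_zero_iff_dvd] at h
    exact_mod_cast h
  have hγN : γ ∈ Gamma0 N := by
    rw [Gamma0_mem, ZMod.intCast_zmod_eq_zero_iff_dvd]
    exact (dvd_mul_right _ _).trans hNMc
  -- `M ∣ c`
  have hMc : (M : ℤ) ∣ γ 1 0 := (dvd_mul_left _ _).trans hNMc
  obtain ⟨c₁, hc₁⟩ := hMc
  have hdet : (!![γ 0 0, γ 0 1; (M : ℤ) * c₁, γ 1 1]).det = 1 := by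
    rw [← hc₁, Matrix.det_fin_two_of]
    have := Matrix.SpecialLinearGroup.det_coe γ
    rw [Matrix.det_fin_two] at this
    linear_combination this
  have hdet' : (!![γ 0 0, (M : ℤ) * γ 0 1; c₁, γ 1 1]).det = 1 := by
    rw [Matrix.det_fin_two_of] at hdet ⊢
    linear_combination hdet
  have hγeq : γ = (⟨!![γ 0 0, γ 0 1; (M : ℤ) * c₁, γ 1 1], hdet⟩ : SL(2, ℤ)) := by
    ext i j
    fin_cases i <;> fin_cases j <;> simp [hc₁]
  set γ' : SL(2, ℤ) := ⟨!![γ 0 0, (M : ℤ) * γ 0 1; c₁, γ 1 1], hdet'⟩ with hγ'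
  have hγ'N : γ' ∈ Gamma0 N := by
    rw [Gamma0_mem]
    simp only [hγ']
    -- `(c₁ : ZMod N) = 0` from `NM ∣ c = M c₁`
    have hNM : ((N : ℤ) * M) ∣ (M : ℤ) * c₁ := hc₁ ▸ hNMc
    have hN : (N : ℤ) ∣ c₁ := by
      have hM0 : (M : ℤ) ≠ 0 := by exact_mod_cast NeZero.ne M
      rw [mul_comm] at hNM
      exact (mul_dvd_mul_iff_left hM0).1 hNM
    simpa [ZMod.intCast_zmod_eq_zero_iff_dvd] using hN
  have hprod := glCast_diagGL_mul_mapGL_of_dvd M (γ 0 0) (γ 0 1) c₁ (γ 1 1) hdet hdet'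
  rw [← hγeq] at hprod
  have hE := eisensteinChar_slash_of_mem_gamma0 (N := N) (k := (k : ℤ)) (χ := χ) hγN
  have hE' := eisensteinChar_slash_of_mem_gamma0 (N := N) (k := (k : ℤ)) (χ := χ) hγ'N
  have hd : ((γ' 1 1 : ℤ) : ZMod N) = ((γ 1 1 : ℤ) : ZMod N) := by simp [hγ']
  rw [hd] at hE'
  -- slash of the `diag(M,1)`-term
  have hslash : (eisensteinChar N k χ ∣[(k : ℤ)] glCast ((diagGL ((M : ℕ) : ℚ) 1
      (Nat.cast_pos.mpr (NeZero.pos M)) one_pos : GL(2, ℚ)⁺) : GL (Fin 2) ℚ)) ∣[(k : ℤ)] γ =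
      χ ((γ 1 1 : ℤ) : ZMod N) • (eisensteinChar N k χ ∣[(k : ℤ)] glCast ((diagGL ((M : ℕ) : ℚ) 1
        (Nat.cast_pos.mpr (NeZero.pos M)) one_pos : GL(2, ℚ)⁺) : GL (Fin 2) ℚ)) := by
    have hmul : (eisensteinChar N k χ ∣[(k : ℤ)] glCast ((diagGL ((M : ℕ) : ℚ) 1
        (Nat.cast_pos.mpr (NeZero.pos M)) one_pos : GL(2, ℚ)⁺) : GL (Fin 2) ℚ)) ∣[(k : ℤ)] γ =
        (eisensteinChar N k χ ∣[(k : ℤ)] γ') ∣[(k : ℤ)] glCast ((diagGL ((M : ℕ) : ℚ) 1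
          (Nat.cast_pos.mpr (NeZero.pos M)) one_pos : GL(2, ℚ)⁺) : GL (Fin 2) ℚ) := by
      rw [ModularForm.SL_slash, ModularForm.SL_slash, ← SlashAction.slash_mul,
        ← SlashAction.slash_mul]
      congr 1
    rw [hmul, hE', ModularForm.smul_slash, σ_glCast]
  rw [coe_eisensteinLevelRaised_eq_smul, ModularForm.SL_smul_slash, sub_smul_slash_SL2, hE, hslash,
    smul_comm _ (χ _), ← smul_sub, smul_comm]

end Nebentypus

/-! ### `q`-expansion and integrality -/

section QExpansion

variable {N : ℕ} [NeZero N] (k : ℕ) (χ : DirichletCharacter ℂ N) (M : ℕ) [NeZero M]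

/-- `(1 : ℝ)` is a strict period of `Γ₁(L)` (private copy of
`HeckeTGamma1.one_mem_strictPeriods_Gamma1`). [folklore] -/
private theorem one_mem_strictPeriods_gamma1 (L : ℕ) :
    (1 : ℝ) ∈ (Gamma1 L : Subgroup (GL (Fin 2) ℝ)).strictPeriods := by simp

/-- **`q`-expansion of the degeneracy slash** `M^{1-k}(E ∣_k diag(M,1)) = E(M·)`:
`∑ a_n q^{Mn}` (Diamond–Shurman §5.7, p. 211, `ι_M`). [cite: DiamondShurman2005, §5.7 p. 211] -/
theorem qExpansion_coeff_heckeCorrespondence_diagGL (hk : 3 ≤ k) (n : ℕ) :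
    (qExpansion 1 ⇑(heckeCorrespondence (Gamma1 N) (Gamma1 (N * M)) k
        (diagGL ((M : ℕ) : ℚ) 1 (Nat.cast_pos.mpr (NeZero.pos M)) one_pos : GL (Fin 2) ℚ)
        (eisensteinE N k χ hk))).coeff n =
      (M : ℂ) ^ ((k : ℤ) - 1) *
        (if M ∣ n then (qExpansion 1 ⇑(eisensteinE N k χ hk)).coeff (n / M) else 0) := by
  have hd : 0 < M := NeZero.pos M
  have hd0 : (M : ℂ) ≠ 0 := Nat.cast_ne_zero.mpr hd.ne'
  set F := heckeCorrespondence (Gamma1 N) (Gamma1 (N * M)) k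
    (diagGL ((M : ℕ) : ℚ) 1 (Nat.cast_pos.mpr (NeZero.pos M)) one_pos : GL (Fin 2) ℚ)
    (eisensteinE N k χ hk) with hF_def
  set g := eisensteinE N k χ hk with hg_def
  -- `F τ = M^{k-1} g(Mτ)`
  have hFτ : ∀ τ : ℍ, F τ = (M : ℂ) ^ ((k : ℤ) - 1) *
      g ⟨(M : ℂ) * τ, by simpa using mul_pos (Nat.cast_pos.mpr hd) τ.2⟩ := fun τ ↦ by
    have h1 := smul_slash_diagGL_apply (k : ℤ) M hd ⇑g τ
    rw [← coe_heckeCorrespondence_diagGL k χ M hk, Pi.smul_apply, smul_eq_mul] at h1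
    have h2 : ((⟨(M : ℝ), Nat.cast_pos.mpr hd⟩ : {x : ℝ // 0 < x}) • τ : ℍ) =
        ⟨(M : ℂ) * τ, by simpa using mul_pos (Nat.cast_pos.mpr hd) τ.2⟩ := by
      apply UpperHalfPlane.ext
      simp [UpperHalfPlane.coe_pos_real_smul]
    rw [h2] at h1
    rw [← h1, ← mul_assoc, ← zpow_add₀ hd0, show (k : ℤ) - 1 + (1 - k) = 0 by ring, zpow_zero,
      one_mul]
  symm
  refine ModularFormClass.qExpansion_coeff_unique one_pos (one_mem_strictPeriods_gamma1 (N * M))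
    (f := F) (c := fun m ↦ (M : ℂ) ^ ((k : ℤ) - 1) *
      (if M ∣ m then (qExpansion 1 ⇑g).coeff (m / M) else 0)) (fun τ ↦ ?_) n
  set τ' : ℍ := ⟨(M : ℂ) * τ, by simpa using mul_pos (Nat.cast_pos.mpr hd) τ.2⟩ with hτ'
  have hg := hasSum_qExpansion_of_mem_strictPeriods one_pos (one_mem_strictPeriods_gamma1 N) g τ'
  have hq : Function.Periodic.qParam 1 (τ' : ℂ) = Function.Periodic.qParam 1 τ ^ M :=
    qParam_one_natMul M τ
  rw [hq] at hg
  rw [hFτ τ]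
  have hg' := hg.mul_left ((M : ℂ) ^ ((k : ℤ) - 1))
  refine ((mul_right_injective₀ hd.ne').hasSum_iff ?_).mp ?_
  · intro m hm
    have : ¬ M ∣ m := by
      rintro ⟨j, rfl⟩
      exact hm ⟨j, rfl⟩
    simp [this]
  · have hfun : ((fun m ↦ ((M : ℂ) ^ ((k : ℤ) - 1) *
        (if M ∣ m then (qExpansion 1 ⇑g).coeff (m / M) else 0)) •
          Function.Periodic.qParam 1 τ ^ m) ∘ fun x ↦ M * x) =
        fun i ↦ (M : ℂ) ^ ((k : ℤ) - 1) *
          ((qExpansion 1 ⇑g).coeff i • (Function.Periodic.qParam 1 τ ^ M) ^ i) := by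
      funext m
      simp only [Function.comp_apply, smul_eq_mul]
      rw [if_pos (dvd_mul_right M m), Nat.mul_div_cancel_left m hd, pow_mul, mul_assoc]
    rw [hfun]
    exact hg'

/-- `q`-expansion of the level change `[Γ₁(N) 1 Γ₁(NM)] E` (same function). [folklore] -/
theorem qExpansion_heckeCorrespondence_one (hk : 3 ≤ k) :
    qExpansion 1 ⇑(heckeCorrespondence (Gamma1 N) (Gamma1 (N * M)) k
        (diagGL ((1 : ℕ) : ℚ) 1 (Nat.cast_pos.mpr Nat.one_pos) one_pos : GL (Fin 2) ℚ)
        (eisensteinE N k χ hk)) = qExpansion 1 ⇑(eisensteinE N k χ hk) := by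
  rw [coe_heckeCorrespondence_one]

/-- **`q`-expansion of `F₂`** in terms of that of `E = E_k^{𝟙,χ}`:
`a_n(F₂) = a_n(E) - [M ∣ n] a_{n/M}(E)`. [cite: BillereyMenares2018, §3.2; DiamondShurman2005, §5.7 p. 211] -/
theorem qExpansion_coeff_eisensteinLevelRaised_eq (hk : 3 ≤ k) (n : ℕ) :
    (qExpansion 1 ⇑(eisensteinLevelRaised N k χ M hk)).coeff n =
      (qExpansion 1 ⇑(eisensteinE N k χ hk)).coeff n -
        (if M ∣ n then (qExpansion 1 ⇑(eisensteinE N k χ hk)).coeff (n / M) else 0) := by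
  have hd0 : (M : ℂ) ≠ 0 := Nat.cast_ne_zero.mpr (NeZero.pos M).ne'
  have h1 := one_mem_strictPeriods_gamma1 (N * M)
  rw [eisensteinLevelRaised, ModularForm.coe_sub, ModularForm.qExpansion_sub one_pos h1, map_sub,
    IsGLPos.coe_smul, ModularForm.qExpansion_smul one_pos h1, map_smul,
    qExpansion_heckeCorrespondence_one, qExpansion_coeff_heckeCorrespondence_diagGL, smul_eq_mul,
    ← mul_assoc, ← zpow_add₀ hd0, show 1 - (k : ℤ) + (k - 1) = 0 by ring, zpow_zero, one_mul]

/-- **The `q`-expansion of `F₂`** (`χ` primitive, `χ(-1) = (-1)^k`, `k ≥ 3`): `a_0(F₂) = 0` and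
`a_n(F₂) = σ_{k-1}^χ(n) - [M ∣ n] σ_{k-1}^χ(n/M)` for `n ≥ 1`, `σ_{k-1}^χ(n) = ∑_{d ∣ n} χ(d) d^{k-1}`.
[cite: BillereyMenares2018, §3.2 with §1.3 (7.1.3)] -/
theorem qExpansion_coeff_eisensteinLevelRaised (hk : 3 ≤ k) (hχ : χ.IsPrimitive)
    (hpar : χ (-1) = (-1) ^ k) (n : ℕ) :
    (qExpansion 1 ⇑(eisensteinLevelRaised N k χ M hk)).coeff n =
      if n = 0 then 0 else
        (∑ d ∈ n.divisors, χ d * (d : ℂ) ^ (k - 1)) -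
          (if M ∣ n then ∑ d ∈ (n / M).divisors, χ d * (d : ℂ) ^ (k - 1) else 0) := by
  rw [qExpansion_coeff_eisensteinLevelRaised_eq, eisensteinE,
    qExpansion_coeff_bernoulli_smul_eisensteinCharMF k χ hk hχ hpar n]
  by_cases hn : n = 0
  · subst hn
    rw [if_pos (dvd_zero M), Nat.zero_div, qExpansion_coeff_bernoulli_smul_eisensteinCharMF k χ hk hχ hpar 0]
    simp
  · rw [if_neg hn, if_neg hn]
    by_cases hMn : M ∣ n
    · have hnM : n / M ≠ 0 := by
        obtain ⟨j, rfl⟩ := hMn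
        rw [Nat.mul_div_cancel_left j (NeZero.pos M)]
        rintro rfl; exact hn (by simp)
      rw [if_pos hMn, if_pos hMn, qExpansion_coeff_bernoulli_smul_eisensteinCharMF k χ hk hχ hpar,
        if_neg hnM]
    · rw [if_neg hMn, if_neg hMn]

/-- **The `q`-expansion of `F₂` is `p`-integral** (`χ` primitive, `χ(-1) = (-1)^k`,
`3 ≤ k < p - 1`, `p ∤ N`; any `ι : ℚ̄_p ≃ ℂ`). [cite: BillereyMenares2018, Lemma 3 and §3.2] -/
theorem valuation_qExpansion_coeff_eisensteinLevelRaised_le_one {p : ℕ} [Fact p.Prime]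
    (ι : PadicAlgCl p ≃+* ℂ) (hk : 3 ≤ k) (hχ : χ.IsPrimitive) (hpar : χ (-1) = (-1) ^ k)
    (hN : ¬ p ∣ N) (hkp : k < p - 1) (n : ℕ) :
    Valued.v (ι.symm ((qExpansion 1 ⇑(eisensteinLevelRaised N k χ M hk)).coeff n)) ≤ 1 := by
  have hE := valuation_qExpansion_coeff_bernoulli_smul_eisensteinCharMF_le_one k χ ι hk hχ hpar hN hkp
  rw [qExpansion_coeff_eisensteinLevelRaised_eq, map_sub]
  refine (Valuation.map_sub _ _ _).trans (max_le ?_ ?_)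
  · exact hE n
  · split_ifs
    · exact hE _
    · rw [map_zero, Valuation.map_zero]; exact zero_le

end QExpansion

/-! ### Constant terms at all cusps -/

section Cusps

variable {N : ℕ} [NeZero N] (k : ℕ) (χ : DirichletCharacter ℂ N) (M : ℕ) [NeZero M]

/-- **Constant term of `F₂ ∣_k γ` at `i∞` when `M ∣ c`: zero.** [cite: BillereyMenares2018, Cor. 5 and §3.2] -/
theorem tendsto_eisensteinLevelRaised_slash_atImInfty_of_dvd (hk : 3 ≤ k) (hMN : M.Coprime N)
    {γ : SL(2, ℤ)} (hγ : (M : ℤ) ∣ γ 1 0) :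
    Tendsto ((⇑(eisensteinLevelRaised N k χ M hk) : ℍ → ℂ) ∣[(k : ℤ)] γ) atImInfty (𝓝 0) := by
  rw [coe_eisensteinLevelRaised_eq_smul, ModularForm.SL_smul_slash]
  have h := (tendsto_levelRaise_slash_atImInfty_of_dvd χ M (k := (k : ℤ)) (by exact_mod_cast hk)
    hMN hγ).const_smul (-(generalizedBernoulli k χ) / (4 * k))
  rwa [smul_zero] at h

/-- **Constant term of `F₂ ∣_k γ` at `i∞` when `gcd(c, M) = 1`:**
`-(B_{k,χ}/4k) χ(d)(1 + χ(-1)(-1)^k)(1 - χ̄(M) M^{-k}) [N ∣ c]`. [cite: BillereyMenares2018, Cor. 5 and §3.2] -/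
theorem tendsto_eisensteinLevelRaised_slash_atImInfty_of_isCoprime (hk : 3 ≤ k)
    (hMN : M.Coprime N) {γ : SL(2, ℤ)} (hγ : IsCoprime (γ 1 0) M) :
    Tendsto ((⇑(eisensteinLevelRaised N k χ M hk) : ℍ → ℂ) ∣[(k : ℤ)] γ) atImInfty
      (𝓝 ((-(generalizedBernoulli k χ) / (4 * k)) *
        (if ((γ 1 0 : ℤ) : ZMod N) = 0 then
          χ ((γ 1 1 : ℤ) : ZMod N) * (1 + χ (-1) * (-1) ^ (k : ℤ)) *
            (1 - χ⁻¹ (M : ZMod N) * (M : ℂ) ^ (-(k : ℤ)))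
        else 0))) := by
  rw [coe_eisensteinLevelRaised_eq_smul, ModularForm.SL_smul_slash]
  exact (tendsto_levelRaise_slash_atImInfty_of_isCoprime χ M (k := (k : ℤ))
    (by exact_mod_cast hk) hMN hγ).const_smul (-(generalizedBernoulli k χ) / (4 * k))

set_option maxHeartbeats 400000 in
/-- **All constant terms of `F₂` vanish modulo `𝔪` when `χ(M) M^k ≡ 1`** (`M` a prime `≠ p`
coprime to `N`, `p ∤ N`, `3 ≤ k < p - 1`, congruences read in `ℚ̄_p` via `ι⁻¹`): for every `γ ∈ SL₂(ℤ)`, `F₂ ∣_k γ → c_γ` at `i∞` with `‖ι⁻¹(c_γ)‖_p < 1`.  This is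
"`ν_𝔭(a_0(F_2 ∣_k γ)) > 0` … using the assumption `η(M)M^k = 1`" of Billerey–Menares §3.2.
[cite: BillereyMenares2018, §3.2 (proof of Thm. 2, ⟸)] -/
theorem exists_tendsto_eisensteinLevelRaised_slash_valuation_lt_one {p : ℕ} [Fact p.Prime]
    (ι : PadicAlgCl p ≃+* ℂ) (hk : 3 ≤ k)
    (hN : ¬ p ∣ N) (hkp : k < p - 1) (hM : M.Prime) (hMp : M ≠ p) (hMN : M.Coprime N)
    (hcong : Valued.v (ι.symm ((χ (M : ZMod N) : ℂ) * (M : ℂ) ^ (k : ℤ)) - 1) < 1)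
    (γ : SL(2, ℤ)) :
    ∃ c : ℂ, Tendsto ((⇑(eisensteinLevelRaised N k χ M hk) : ℍ → ℂ) ∣[(k : ℤ)] γ) atImInfty (𝓝 c) ∧
      Valued.v (ι.symm c) < 1 := by
  rcases dvd_or_isCoprime_of_prime hM (γ 1 0) with hdvd | hcop
  · exact ⟨0, tendsto_eisensteinLevelRaised_slash_atImInfty_of_dvd k χ M hk hMN hdvd,
      by rw [map_zero, Valuation.map_zero]; exact zero_lt_one⟩
  · refine ⟨_, tendsto_eisensteinLevelRaised_slash_atImInfty_of_isCoprime k χ M hk hMN hcop, ?_⟩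
    split_ifs with hc
    · -- integrality of `-(B/4k) χ(d) (1 + χ(-1)(-1)^k)` and the unit `χ̄(M) M^{-k}`
      set S : Subring ℂ :=
        ((Valued.v (R := PadicAlgCl p)).valuationSubring.toSubring).comap ι.symm.toRingHom with hS
      have hmem : ∀ x : ℂ, x ∈ S ↔ Valued.v (ι.symm x) ≤ 1 := fun x ↦ by
        simp [hS, Valuation.mem_valuationSubring_iff]
      have hχS : ∀ j, χ j ∈ S := fun j ↦ (hmem _).2 (valuation_ringEquiv_symm_apply_le_one χ ι j)
      have hratS : ∀ q : ℚ, Rat.padicValuation p q ≤ 1 → algebraMap ℚ ℂ q ∈ S := fun q hq ↦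
        (hmem _).2 (valuation_ringEquiv_symm_ratCast_le_one ι hq)
      have hB : generalizedBernoulli k χ ∈ S := generalizedBernoulli_mem_subring χ S hχS hratS hN hkp
      have hq : Rat.padicValuation p (-(1 / (4 * k)) : ℚ) ≤ 1 := by
        have h4k : ¬ p ∣ 4 * k := by
          intro h
          rcases (Nat.Prime.dvd_mul Fact.out).1 h with h2 | h2
          · have := Nat.le_of_dvd (by norm_num) h2
            omega
          · have := Nat.le_of_dvd (by omega) h2
            omega
        rw [Valuation.map_neg, map_div₀, map_one,
          show ((4 * k : ℚ)) = ((4 * k : ℕ) : ℚ) by push_cast; ring,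
          padicValuation_natCast_eq_one h4k, div_one]
      have hcoef : -(generalizedBernoulli k χ) / (4 * k) ∈ S := by
        have h := Subring.mul_mem S hB (hratS _ hq)
        convert h using 1
        rw [map_neg, map_div₀, map_one, map_mul, map_natCast, eq_ratCast, Rat.cast_ofNat]
        ring
      have hpar' : (1 + χ (-1) * (-1) ^ (k : ℤ)) ∈ S := by
        refine Subring.add_mem S (Subring.one_mem S) (Subring.mul_mem S (hχS _) ?_)
        rw [zpow_natCast]; exact Subring.pow_mem S (Subring.neg_mem S (Subring.one_mem S)) _
      have hA : -(generalizedBernoulli k χ) / (4 * k) * (χ ((γ 1 1 : ℤ) : ZMod N) *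
          (1 + χ (-1) * (-1) ^ (k : ℤ))) ∈ S :=
        Subring.mul_mem S hcoef (Subring.mul_mem S (hχS _) hpar')
      -- the factor `1 - χ̄(M) M^{-k} = -(χ̄(M) M^{-k}) (χ(M) M^k - 1)`
      have hMunit : IsUnit ((M : ZMod N)) := (ZMod.isUnit_iff_coprime M N).2 hMN
      have hχM : χ⁻¹ (M : ZMod N) * χ (M : ZMod N) = 1 := by
        rw [← MulChar.mul_apply, inv_mul_cancel, MulChar.one_apply hMunit]
      have hM0 : (M : ℂ) ≠ 0 := by exact_mod_cast hM.ne_zero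
      have hfac : (1 - χ⁻¹ (M : ZMod N) * (M : ℂ) ^ (-(k : ℤ))) =
          (χ⁻¹ (M : ZMod N) * (M : ℂ) ^ (-(k : ℤ))) * (χ (M : ZMod N) * (M : ℂ) ^ (k : ℤ) - 1) := by
        have : χ⁻¹ (M : ZMod N) * (M : ℂ) ^ (-(k : ℤ)) * (χ (M : ZMod N) * (M : ℂ) ^ (k : ℤ)) = 1 := by
          calc _ = (χ⁻¹ (M : ZMod N) * χ (M : ZMod N)) * ((M : ℂ) ^ (-(k : ℤ)) * (M : ℂ) ^ (k : ℤ)) := by ring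
            _ = 1 := by rw [hχM, ← zpow_add₀ hM0, neg_add_cancel, zpow_zero, mul_one]
        linear_combination -this
      -- valuations
      have hv1 : Valued.v (ι.symm (-(generalizedBernoulli k χ) / (4 * k) *
          (χ ((γ 1 1 : ℤ) : ZMod N) * (1 + χ (-1) * (-1) ^ (k : ℤ))))) ≤ 1 := (hmem _).1 hA
      have hMv : Valued.v ((M : PadicAlgCl p)) = 1 := by
        rw [PadicAlgCl.valuation_def, ← map_natCast (algebraMap ℚ_[p] (PadicAlgCl p)) M]
        change (‖((M : ℚ_[p]) : PadicAlgCl p)‖₊ : ℝ≥0) = 1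
        rw [← NNReal.coe_inj, coe_nnnorm, NNReal.coe_one, PadicAlgCl.norm_extends,
          Padic.norm_natCast_eq_one_iff]
        exact (Nat.coprime_primes Fact.out hM).2 hMp.symm
      have hv2 : Valued.v (ι.symm (χ⁻¹ (M : ZMod N) * (M : ℂ) ^ (-(k : ℤ)))) ≤ 1 := by
        have h1 : Valued.v (ι.symm (χ⁻¹ (M : ZMod N))) ≤ 1 :=
          valuation_ringEquiv_symm_apply_le_one χ⁻¹ ι _
        have h2 : Valued.v (ι.symm ((M : ℂ) ^ (-(k : ℤ)))) = 1 := by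
          rw [map_zpow₀, map_natCast ι.symm, map_zpow₀, hMv, _root_.one_zpow]
        rw [map_mul, Valuation.map_mul, h2, mul_one]
        exact h1
      have hv3 : Valued.v (ι.symm (χ (M : ZMod N) * (M : ℂ) ^ (k : ℤ) - 1)) < 1 := by
        rw [map_sub, map_one]; exact hcong
      have hX : -(generalizedBernoulli k χ) / (4 * k) * (χ ((γ 1 1 : ℤ) : ZMod N) *
          (1 + χ (-1) * (-1) ^ (k : ℤ)) * (1 - χ⁻¹ (M : ZMod N) * (M : ℂ) ^ (-(k : ℤ)))) =
          (-(generalizedBernoulli k χ) / (4 * k) * (χ ((γ 1 1 : ℤ) : ZMod N) *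
            (1 + χ (-1) * (-1) ^ (k : ℤ)))) * (χ⁻¹ (M : ZMod N) * (M : ℂ) ^ (-(k : ℤ))) *
              (χ (M : ZMod N) * (M : ℂ) ^ (k : ℤ) - 1) := by
        rw [hfac]; simp only [mul_assoc]
      rw [hX, map_mul ι.symm, map_mul ι.symm, Valuation.map_mul, Valuation.map_mul]
      calc _ ≤ 1 * 1 * Valued.v (ι.symm (χ (M : ZMod N) * (M : ℂ) ^ (k : ℤ) - 1)) :=
            mul_le_mul' (mul_le_mul' hv1 hv2) le_rfl
        _ < 1 := by rw [one_mul, one_mul]; exact hv3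
    · rw [mul_zero, map_zero, Valuation.map_zero]; exact zero_lt_one

end Cusps

end Literature.NumberTheory.EllipticCurves.ModularForms
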